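import Summits.QuantumFields.BalabanUV.Beta.D1BFx.GhostStencilRooted
import Summits.QuantumFields.BalabanUV.Beta.D1BFx.GhostLegWard

/-!
# `BalabanUV.Beta.D1BFx.GhostLegWardRooted` — road «BF-x» for binder row D1, sub-leaf T6-ρ (part C): THE FIRST-ORDER WARD SOCKET (W1)
# FOR THE ROOT-PARAMETRIC STENCIL — `(Ggh ∘ divV (SghAt ρ n (c·n²) (c·a)) u) ∘ Ggh = Ggh ∘ X u − X u ∘ Ggh`, `X u = (−c) • genX u`,
# for EVERY in-block root `ρ` (gauge covariance does not see the root): part 5a/5b's argument with the root term `[n•Y + ρ = u]` cancelling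

HONEST DEPENDENCY (page 1, mandatory): continuum YM on T⁴ ⇐ BetaPertH ∧ nine spine estimates (0/9 proved); BetaPertH ⇐ (D1) ∧ (D4) ∧
CAP+tail; G-an2-4 gates asym, D1 and NE2/3/4.  HONEST FRAMING (cell contract, verbatim): «discharging `BetaPertH` makes Bałaban's UV
stability UNCONDITIONAL — a real constructive-QFT result; it is NOT the continuum limit and NOT the Clay problem.»  THIS FILE DISCHARGES
NOTHING of D1 / BetaPertH: [folklore] bookkeeping over parts 5a/5b/6A BY NAME; no definition, no `def … : Prop`, no citation, nothing
printed; 0 binders of the hR root are touched.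
ABSOLUTE RULE (cell charter, verbatim): «No internally-minted statement may enter as a cited fact. Every hypothesis is either
kernel-proved in this package or a verbatim quotation of a PUBLISHED theorem with page reference. The manuscript(s) under audit are NOT
citable for their own disputed steps — they are the thing under adjudication; programme-internal (2001/route/tribunal) claims are never
citable.»

CONTENT.
* §1 [folklore] `sum_qJetAt_div` (`Σ_μ (qJetAt ρ n μ (u−e_μ) Y w − qJetAt ρ n μ u Y w) = [blk w = Y]·(n⁴)⁻¹·([w = u] − [n•Y + ρ = u])`, in-block
  root), **`div_qAntiAt_apply`** (the root terms cancel: the SAME right-hand side as T6 v1's `div_qAnti_apply`), `divV_SghAt_apply`,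
  **`divV_SghAt_eq : divV (SghAt ρ n (c·n²) (c·a)) u = c • (Oker n a ∘ genX u − genX u ∘ Oker n a)`**.
* §2 [folklore] **`ward₁_Ggh_rooted`**: the END's `hW1` VERBATIM for `SghAt ρ` at `(cK, cQ) = (c·n², c·a)`, `X u = (−c) • genX u`, every
  in-block `ρ`, `0 < a` — in particular for the centre root `ρ = ctrHalf n` of part 6B.
Unit `b2b-balaban-beta-d1-formalise-leaf-01` (gen 3).
-/

noncomputable section

namespace Summit.QuantumFields.BalabanUV.Beta.D1BFx.GhostLegWardRooted

open Finset
open scoped BigOperators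
open Literature.MathematicalPhysics.QuantumFieldTheory.Balaban1983to89
open Literature.MathematicalPhysics.QuantumFieldTheory.Balaban1983to89.Beta
open B6QGQLower276 (blk sameBlk AX)
open ExpKernelCalculus (Site MKer comp)
open AffineAveraging (unitVec unitVec_apply)
open KernelWard (divV)
open Summit.QuantumFields.BalabanUV.Beta.D1BFx.GhostLeg (Ggh)
open Summit.QuantumFields.BalabanUV.Beta.D1BFx.GhostStencil (ghCur)
open Summit.QuantumFields.BalabanUV.Beta.D1BFx.GhostStencilWard (genX comp_genX_left comp_genX_right unitVec_eq comp_unit_apply)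
open Summit.QuantumFields.BalabanUV.Beta.D1BFx.GhostStencilDivergence (Oker Oker_apply sum_gammaCoeff_div div_ghCur_apply)
open Summit.QuantumFields.BalabanUV.Beta.D1BFx.GhostStencilRooted (qJetAt qAntiAt qAntiAt_apply SghAt SghAt_apply qJetAt_eq_unguarded)
open Summit.QuantumFields.BalabanUV.Beta.D1BFx.GhostLegWard (comp_Ggh_comm_apply comm_resolvent_apply)

variable {ρ : Site 4} (n : ℕ) [NeZero n]

/-! ## §1 The divergence of the root-parametric stencil -/

/-- [folklore] The telescoped block sum for the rooted jet (in-block root): `Σ_μ (qJetAt ρ n μ (u−e_μ) Y w − qJetAt ρ n μ u Y w)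
= [blk w = Y]·(n⁴)⁻¹·([w = u] − [n•Y + ρ = u])`. -/
theorem sum_qJetAt_div (hρ : ∀ i : Fin 4, 0 ≤ ρ i ∧ ρ i < n) (u Y w : Site 4) :
    (∑ μ : Fin 4, (qJetAt ρ n μ (u - unitVec μ) Y w - qJetAt ρ n μ u Y w))
      = if blk (n - 1) w = Y then
          ((n : ℝ) ^ 4)⁻¹ * ((if w = u then (1 : ℝ) else 0) - (if (n : ℤ) • Y + ρ = u then 1 else 0)) else 0 := by
  simp only [qJetAt_eq_unguarded n hρ]
  by_cases hw : blk (n - 1) w = Y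
  · simp only [if_pos hw, ← mul_sub, ← Finset.mul_sum, sum_gammaCoeff_div]
  · simp only [if_neg hw, sub_zero, Finset.sum_const_zero]

/-- [folklore] **DIVERGENCE OF THE ROOTED AVERAGING JET** (in-block root; the root terms cancel in the antisymmetrisation):
`Σ_μ (qAntiAt ρ n μ (u−e_μ) − qAntiAt ρ n μ u)(x,z) = (n⁴)⁻¹·(sameBlk x u·[z = u] − [x = u]·sameBlk u z)` — the same right-hand side as T6 v1's. -/
theorem div_qAntiAt_apply (hρ : ∀ i : Fin 4, 0 ≤ ρ i ∧ ρ i < n) (u x z : Site 4) :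
    (∑ μ : Fin 4, (qAntiAt ρ n μ (u - unitVec μ) x z () () - qAntiAt ρ n μ u x z () ()))
      = ((n : ℝ) ^ 4)⁻¹ * (sameBlk (n - 1) x u * (if z = u then 1 else 0) - (if x = u then 1 else 0) * sameBlk (n - 1) u z) := by
  have hsplit : (∑ μ : Fin 4, (qAntiAt ρ n μ (u - unitVec μ) x z () () - qAntiAt ρ n μ u x z () ()))
      = (∑ μ : Fin 4, (qJetAt ρ n μ (u - unitVec μ) (blk (n - 1) x) z - qJetAt ρ n μ u (blk (n - 1) x) z))
        - ∑ μ : Fin 4, (qJetAt ρ n μ (u - unitVec μ) (blk (n - 1) z) x - qJetAt ρ n μ u (blk (n - 1) z) x) := by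
    rw [← Finset.sum_sub_distrib]
    refine Finset.sum_congr rfl fun μ _ => ?_
    rw [qAntiAt_apply, qAntiAt_apply]
    ring
  rw [hsplit, sum_qJetAt_div n hρ, sum_qJetAt_div n hρ]
  unfold sameBlk
  by_cases hb : blk (n - 1) x = blk (n - 1) z
  · rw [if_pos hb.symm, if_pos hb, hb]
    by_cases hzu : z = u
    · subst hzu
      simp only [if_true]
      ring
    · rw [if_neg hzu, mul_zero, zero_sub, zero_sub]
      by_cases hxu : x = u
      · subst hxu
        rw [if_pos rfl, if_pos hb]; ring
      · rw [if_neg hxu]; ring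
  · have hb' : ¬(blk (n - 1) z = blk (n - 1) x) := fun h => hb h.symm
    rw [if_neg hb', if_neg hb, sub_zero]
    by_cases hzu : z = u
    · subst hzu
      rw [if_neg hb, zero_mul, zero_sub]
      by_cases hxz : x = z
      · exact absurd (congrArg (blk (n - 1)) hxz) hb
      · rw [if_neg hxz, zero_mul, neg_zero, mul_zero]
    · rw [if_neg hzu, mul_zero, zero_sub]
      by_cases hxu : x = u
      · subst hxu
        rw [if_neg hb, if_pos rfl, one_mul, neg_zero, mul_zero]
      · rw [if_neg hxu, zero_mul, neg_zero, mul_zero]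

/-- [folklore] **THE PURE-GAUGE DIVERGENCE OF THE ROOTED STENCIL, ENTRYWISE** (in-block root, weights `(c·n², c·a)`):
`divV (SghAt ρ n (c·n²) (c·a)) u (x,z) = c·(Oker x u·[z = u] − [x = u]·Oker u z)`. -/
theorem divV_SghAt_apply (hρ : ∀ i : Fin 4, 0 ≤ ρ i ∧ ρ i < n) (a c : ℝ) (u x z : Site 4) (p q : Unit) :
    divV (SghAt ρ n (c * (n : ℝ) ^ 2) (c * a)) u x z p q
      = c * (Oker n a x u p q * (if z = u then 1 else 0) - (if x = u then 1 else 0) * Oker n a u z p q) := by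
  obtain rfl : p = () := Subsingleton.elim _ _
  obtain rfl : q = () := Subsingleton.elim _ _
  have hn : (n : ℝ) ≠ 0 := by exact_mod_cast NeZero.ne n
  unfold divV
  simp only [Finset.sum_apply, Pi.sub_apply, SghAt_apply, unitVec_eq]
  have hre : ∀ μ : Fin 4, c * (n : ℝ) ^ 2 * ghCur μ (u - unitVec μ) x z () () + c * a * qAntiAt ρ n μ (u - unitVec μ) x z () ()
      - (c * (n : ℝ) ^ 2 * ghCur μ u x z () () + c * a * qAntiAt ρ n μ u x z () ())
      = c * (n : ℝ) ^ 2 * (ghCur μ (u - unitVec μ) x z () () - ghCur μ u x z () ())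
        + c * a * (qAntiAt ρ n μ (u - unitVec μ) x z () () - qAntiAt ρ n μ u x z () ()) := fun μ => by ring
  simp only [hre, Finset.sum_add_distrib, ← Finset.mul_sum, div_ghCur_apply, div_qAntiAt_apply n hρ, Oker_apply]
  field_simp
  ring

/-- [folklore] **`divV (SghAt ρ n (c·n²) (c·a)) u = c • (Oker n a ∘ genX u − genX u ∘ Oker n a)`** for EVERY in-block root `ρ`:
the divergence of the rooted stencil is the SAME commutator as T6 v1's (`GhostStencilDivergence.divV_Sgh_eq`). -/
theorem divV_SghAt_eq (hρ : ∀ i : Fin 4, 0 ≤ ρ i ∧ ρ i < n) (a c : ℝ) (u : Site 4) :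
    divV (SghAt ρ n (c * (n : ℝ) ^ 2) (c * a)) u = c • (comp (Oker n a) (genX u) - comp (genX u) (Oker n a)) := by
  funext x z p q
  rw [divV_SghAt_apply n hρ, Pi.smul_apply, Pi.smul_apply, Pi.smul_apply, Pi.smul_apply, Pi.sub_apply, Pi.sub_apply, Pi.sub_apply,
    Pi.sub_apply, smul_eq_mul, comp_genX_right, comp_genX_left]

/-! ## §2 (W1) for the root-parametric stencil -/

/-- [folklore] **(W1) FOR T2's GHOST LEG AND THE ROOT-PARAMETRIC STENCIL** (every in-block root `ρ`, `0 < a`, every real `c`):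
`(Ggh ∘ divV (SghAt ρ n (c·n²) (c·a)) u) ∘ Ggh = Ggh ∘ X u − X u ∘ Ggh`, `X u = (−c) • genX u` — the END's `hW1` VERBATIM for the
re-rooted stencil (for `ρ = ctrHalf n`: `GhostStencilRootedReflection.ctrHalf_mem`). -/
theorem ward₁_Ggh_rooted (hρ : ∀ i : Fin 4, 0 ≤ ρ i ∧ ρ i < n) {a : ℝ} (ha : 0 < a) (c : ℝ) (u : Site 4) :
    comp (comp (Ggh n a) (divV (SghAt ρ n (c * (n : ℝ) ^ 2) (c * a)) u)) (Ggh n a)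
      = comp (Ggh n a) ((-c) • genX u) - comp ((-c) • genX u) (Ggh n a) := by
  rw [divV_SghAt_eq n hρ, KernelReflection.comp_smul_right, KernelReflection.comp_smul_left, KernelReflection.comp_smul_right,
    KernelReflection.comp_smul_left]
  funext x y p q
  obtain rfl : p = () := Subsingleton.elim _ _
  obtain rfl : q = () := Subsingleton.elim _ _
  rw [Pi.smul_apply, Pi.smul_apply, Pi.smul_apply, Pi.smul_apply, smul_eq_mul, Pi.sub_apply, Pi.sub_apply, Pi.sub_apply,
    Pi.sub_apply, Pi.smul_apply, Pi.smul_apply, Pi.smul_apply, Pi.smul_apply, Pi.smul_apply, Pi.smul_apply, Pi.smul_apply,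
    Pi.smul_apply, smul_eq_mul, smul_eq_mul, comp_genX_right, comp_genX_left,
    comp_unit_apply (comp (Ggh n a) _) (Ggh n a)]
  have hf : ∀ z : Site 4, comp (Ggh n a) (comp (Oker n a) (genX u) - comp (genX u) (Oker n a)) x z () () * Ggh n a z y () ()
      = ((if z = u then (1 : ℝ) else 0) * (if x = u then 1 else 0) - Ggh n a x u () () * AX (n - 1) a u z) * Ggh n a z y () () :=
    fun z => by rw [comp_Ggh_comm_apply n a ha]
  rw [tsum_congr hf, comm_resolvent_apply n a ha]
  ring

end Summit.QuantumFields.BalabanUV.Beta.D1BFx.GhostLegWardRooted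

end
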